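import Mathlib
import Summits.NavierStokesRegularity.NavierStokesRegularity.Theorems.LevelSetModerationHighSpeedPressureWorkSliceMeasurability
import Summits.NavierStokesRegularity.NavierStokesRegularity.Theorems.LevelSetModerationHighSpeedPressureWorkLinearLawOfCrux
import Summits.NavierStokesRegularity.NavierStokesRegularity.Theorems.LevelSetModerationHighSpeedPressureWorkConsequences
import Summits.NavierStokesRegularity.NavierStokesRegularity.Theorems.LevelSetModerationLevelSetClosure

/-!
# Route LevelSetModeration — crux 2 `HighSpeedPressureWork`: the crux implies the iso-speed AREA LAW

Proof file for item stmt-NavierStokesRegularity-18149 (`HighSpeedPressureWork`), line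
`iso-speed-area-closure`: the line's OPEN stub `stub_isoSpeedAreaLaw` (ν·(iso-speed area above c) ≤
Λ₁ M^{m₁}·(occupation above c), m₁ < 5/3) is IMPLIED by the crux — so that, with the line's
composition, the crux is EQUIVALENT to the area law modulo the bounded bookkeeping L3.

* `levelSetModeration_isoSpeedArea_le_sqrt` — Cauchy–Schwarz on `(0,T) × ℝ³`:
  `𝒟¹_c(T) ≤ V_c(T)^{1/2} · D_c(T)^{1/2}` (extended reals; Hölder for the product measure applied to the
  density of `levelSetModeration_aemeasurable_dissipationSlice`, jointly a.e.-measurable because it is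
  continuous on the relatively open set `{c < |u|}` of the slab).
* `levelSetModeration_isoSpeedAreaLaw_of_highSpeedPressureWork` — crux ⇒ area law with
  `m₁ = m/2 < 5/3`, `Λ₁ = √(Λ⁺)`: `ν𝒟¹ ≤ √V √(ν²D) ≤ √V √(Λ M^m V) = √Λ M^{m/2} V`, through the
  landed `levelSetModeration_linearLevelSetLaw_of_highSpeedPressureWork` (crux ⇒ L1).
-/

noncomputable section

-- single-conjunct summit: `Summit.<Summit>.<Problem>` repeats the name by the D-0017 layout
set_option linter.dupNamespace false

namespace Summit.NavierStokesRegularity.NavierStokesRegularity.Theorems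

open MeasureTheory Set Filter Topology Function
open scoped ENNReal RealInnerProductSpace
open Literature.Analysis.FluidPDE

/-- **Cauchy–Schwarz for the iso-speed area.** For a velocity field jointly smooth on `[0, T) × ℝ³`
with smooth slices and a level `c > 0`:
`∫₀ᵀ∫ 1_{|u|>c} ‖∇|u|‖ ≤ (∫₀ᵀ |{|u|>c}|)^{1/2} · (∫₀ᵀ∫ 1_{|u|>c} ‖∇|u|‖²)^{1/2}` (extended reals; Hölder
on `(0,T) × ℝ³` for the jointly a.e.-measurable density of the speed gradient on `{c < |u|}`).
[folklore] -/
theorem levelSetModeration_isoSpeedArea_le_sqrt {T : ℝ}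
    {u : ℝ → EuclideanSpace ℝ (Fin 3) → EuclideanSpace ℝ (Fin 3)}
    (hu : IsSmoothSpaceTimeOn (Ico 0 T) u) {c : ℝ} (hc : 0 < c) :
    (∫⁻ τ in Ioo 0 T, ∫⁻ x, {x | c < ‖u τ x‖}.indicator
        (fun x => ENNReal.ofReal ‖fderiv ℝ (fun y => ‖u τ y‖) x‖) x) ≤
      (∫⁻ τ in Ioo 0 T, volume {x | c < ‖u τ x‖}) ^ (1 / 2 : ℝ) *
        (∫⁻ τ in Ioo 0 T, ∫⁻ x, {x | c < ‖u τ x‖}.indicator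
          (fun x => ENNReal.ofReal (‖fderiv ℝ (fun y => ‖u τ y‖) x‖ ^ 2)) x) ^ (1 / 2 : ℝ) := by
  rcases le_or_gt T 0 with hT0 | hT0
  · rw [Ioo_eq_empty (not_lt.2 hT0), Measure.restrict_empty]
    simp
  set Ω : Set (ℝ × EuclideanSpace ℝ (Fin 3)) := Ico 0 T ×ˢ univ with hΩ
  have hUΩ : UniqueDiffOn ℝ (Ico 0 T) := uniqueDiffOn_Ico 0 T
  set W : Set (ℝ × EuclideanSpace ℝ (Fin 3)) := {z | z ∈ Ω ∧ c < ‖uncurry u z‖} with hW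
  have hcontu : ContinuousOn (uncurry u) Ω := hu.continuousOn
  have hWmeas : MeasurableSet W := levelSetModeration_measurableSet_superlevel_slab hcontu c
  have hWΩ : W ⊆ Ω := fun z hz => hz.1
  -- the density (power one) and its square
  set Dslab : ℝ × EuclideanSpace ℝ (Fin 3) →
      (ℝ × EuclideanSpace ℝ (Fin 3) →L[ℝ] EuclideanSpace ℝ (Fin 3)) :=
    fderivWithin ℝ (uncurry u) Ω with hDslab
  set L : ℝ × EuclideanSpace ℝ (Fin 3) → (EuclideanSpace ℝ (Fin 3) →L[ℝ] ℝ) := fun z =>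
    (‖uncurry u z‖⁻¹ • innerSL ℝ (uncurry u z)).comp
      ((Dslab z).comp (ContinuousLinearMap.inr ℝ ℝ (EuclideanSpace ℝ (Fin 3)))) with hL
  set G₁ : ℝ × EuclideanSpace ℝ (Fin 3) → ℝ≥0∞ := fun z => ENNReal.ofReal ‖L z‖ with hG₁
  set G₂ : ℝ × EuclideanSpace ℝ (Fin 3) → ℝ≥0∞ := fun z => ENNReal.ofReal (‖L z‖ ^ 2) with hG₂
  have hDcont : ContinuousOn Dslab Ω := (hu.contDiffOn_fderivWithin hUΩ).continuousOn
  have hLcont : ContinuousOn L W := by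
    have hne : ∀ z ∈ W, ‖uncurry u z‖ ≠ 0 := fun z hz => (hc.trans hz.2).ne'
    have h1 : ContinuousOn (fun z => ‖uncurry u z‖⁻¹) W := (hcontu.mono hWΩ).norm.inv₀ hne
    have h2 : ContinuousOn (fun z => innerSL ℝ (uncurry u z)) W :=
      (innerSL ℝ).continuous.comp_continuousOn (hcontu.mono hWΩ)
    have h3 : ContinuousOn (fun z => (Dslab z).comp
        (ContinuousLinearMap.inr ℝ ℝ (EuclideanSpace ℝ (Fin 3)))) W :=
      ((hDcont.mono hWΩ).clm_comp continuousOn_const)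
    exact (h1.smul h2).clm_comp h3
  have hG₁cont : ContinuousOn G₁ W := ENNReal.continuous_ofReal.comp_continuousOn hLcont.norm
  have hG₂cont : ContinuousOn G₂ W := ENNReal.continuous_ofReal.comp_continuousOn (hLcont.norm.pow 2)
  -- the product measure
  set μ : Measure (ℝ × EuclideanSpace ℝ (Fin 3)) :=
    (volume.restrict (Ioo 0 T)).prod (volume : Measure (EuclideanSpace ℝ (Fin 3))) with hμ
  have hf : AEMeasurable (W.indicator fun _ => (1 : ℝ≥0∞)) μ :=
    (measurable_const.indicator hWmeas).aemeasurable
  have hg₁ : AEMeasurable (W.indicator G₁) μ := by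
    rw [aemeasurable_indicator_iff hWmeas]; exact hG₁cont.aemeasurable hWmeas
  have hg₂ : AEMeasurable (W.indicator G₂) μ := by
    rw [aemeasurable_indicator_iff hWmeas]; exact hG₂cont.aemeasurable hWmeas
  -- Hölder on the product
  have hpq : Real.HolderConjugate 2 2 := ⟨by norm_num, by norm_num, by norm_num⟩
  have hH := ENNReal.lintegral_mul_le_Lp_mul_Lq μ hpq hf hg₁
  -- rewrite the three product integrals
  have hprod1 : (fun z => (W.indicator (fun _ => (1 : ℝ≥0∞)) * W.indicator G₁) z) = W.indicator G₁ := by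
    funext z
    by_cases hz : z ∈ W
    · simp only [Pi.mul_apply, indicator_of_mem hz, one_mul]
    · simp only [Pi.mul_apply, indicator_of_notMem hz, mul_zero]
  have hpow1 : (fun z => W.indicator (fun _ => (1 : ℝ≥0∞)) z ^ (2 : ℝ)) =
      W.indicator fun _ => (1 : ℝ≥0∞) := by
    funext z
    by_cases hz : z ∈ W
    · simp only [indicator_of_mem hz, ENNReal.one_rpow]
    · simp only [indicator_of_notMem hz, ENNReal.zero_rpow_of_pos (by norm_num : (0:ℝ) < 2)]
  have hpow2 : (fun z => W.indicator G₁ z ^ (2 : ℝ)) = W.indicator G₂ := by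
    funext z
    by_cases hz : z ∈ W
    · simp only [indicator_of_mem hz, hG₁, hG₂]
      rw [ENNReal.ofReal_rpow_of_nonneg (norm_nonneg _) (by norm_num), Real.rpow_two]
    · simp only [indicator_of_notMem hz, ENNReal.zero_rpow_of_pos (by norm_num : (0:ℝ) < 2)]
  rw [hprod1] at hH
  simp only [hpow1, hpow2] at hH
  -- Tonelli: product integrals are the iterated slice integrals
  have hI1 : ∫⁻ z, W.indicator G₁ z ∂μ = ∫⁻ τ in Ioo 0 T, ∫⁻ x, {x | c < ‖u τ x‖}.indicator
      (fun x => ENNReal.ofReal ‖fderiv ℝ (fun y => ‖u τ y‖) x‖) x := by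
    rw [hμ, lintegral_prod _ hg₁]
    refine setLIntegral_congr_fun measurableSet_Ioo fun τ hτ => ?_
    have hτ' : τ ∈ Ico 0 T := ⟨hτ.1.le, hτ.2⟩
    refine lintegral_congr fun x => ?_
    by_cases hx : c < ‖u τ x‖
    · have hzW : (τ, x) ∈ W := ⟨mk_mem_prod hτ' (mem_univ x), hx⟩
      rw [indicator_of_mem hzW, indicator_of_mem (show x ∈ {x | c < ‖u τ x‖} from hx), hG₁]
      have hx0 : u τ x ≠ 0 := by
        intro h0; rw [h0, norm_zero] at hx; exact absurd hx (not_lt.2 hc.le)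
      have hdu : DifferentiableAt ℝ (u τ) x :=
        ((hu.contDiff_slice hτ').differentiable (by simp)) x
      have hchain : fderiv ℝ (fun y => ‖u τ y‖) x =
          (‖u τ x‖⁻¹ • innerSL ℝ (u τ x)).comp (fderiv ℝ (u τ) x) := by
        have h := (LevelSetEnergyInequality.hasFDerivAt_norm_of_ne_zero hx0).comp x hdu.hasFDerivAt
        exact h.fderiv
      rw [hchain, hu.fderiv_slice_eq hτ' x]
      rfl
    · have hzW : (τ, x) ∉ W := fun h => hx h.2
      rw [indicator_of_notMem hzW, indicator_of_notMem (show x ∉ {x | c < ‖u τ x‖} from hx)]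
  have hI2 : ∫⁻ z, W.indicator G₂ z ∂μ = ∫⁻ τ in Ioo 0 T, ∫⁻ x, {x | c < ‖u τ x‖}.indicator
      (fun x => ENNReal.ofReal (‖fderiv ℝ (fun y => ‖u τ y‖) x‖ ^ 2)) x := by
    rw [hμ, lintegral_prod _ hg₂]
    refine setLIntegral_congr_fun measurableSet_Ioo fun τ hτ => ?_
    have hτ' : τ ∈ Ico 0 T := ⟨hτ.1.le, hτ.2⟩
    refine lintegral_congr fun x => ?_
    by_cases hx : c < ‖u τ x‖
    · have hzW : (τ, x) ∈ W := ⟨mk_mem_prod hτ' (mem_univ x), hx⟩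
      rw [indicator_of_mem hzW, indicator_of_mem (show x ∈ {x | c < ‖u τ x‖} from hx), hG₂]
      have hx0 : u τ x ≠ 0 := by
        intro h0; rw [h0, norm_zero] at hx; exact absurd hx (not_lt.2 hc.le)
      have hdu : DifferentiableAt ℝ (u τ) x :=
        ((hu.contDiff_slice hτ').differentiable (by simp)) x
      have hchain : fderiv ℝ (fun y => ‖u τ y‖) x =
          (‖u τ x‖⁻¹ • innerSL ℝ (u τ x)).comp (fderiv ℝ (u τ) x) := by
        have h := (LevelSetEnergyInequality.hasFDerivAt_norm_of_ne_zero hx0).comp x hdu.hasFDerivAt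
        exact h.fderiv
      rw [hchain, hu.fderiv_slice_eq hτ' x]
      rfl
    · have hzW : (τ, x) ∉ W := fun h => hx h.2
      rw [indicator_of_notMem hzW, indicator_of_notMem (show x ∉ {x | c < ‖u τ x‖} from hx)]
  have hI0 : ∫⁻ z, W.indicator (fun _ => (1 : ℝ≥0∞)) z ∂μ = ∫⁻ τ in Ioo 0 T, volume {x | c < ‖u τ x‖} := by
    rw [hμ, lintegral_prod _ hf]
    refine setLIntegral_congr_fun measurableSet_Ioo fun τ hτ => ?_
    have hτ' : τ ∈ Ico 0 T := ⟨hτ.1.le, hτ.2⟩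
    have hA : MeasurableSet {x | c < ‖u τ x‖} :=
      (isOpen_lt continuous_const (hu.continuous_slice hτ').norm).measurableSet
    rw [← lintegral_indicator_one hA]
    refine lintegral_congr fun x => ?_
    by_cases hx : c < ‖u τ x‖
    · have hzW : (τ, x) ∈ W := ⟨mk_mem_prod hτ' (mem_univ x), hx⟩
      rw [indicator_of_mem hzW, indicator_of_mem (show x ∈ {x | c < ‖u τ x‖} from hx)]
      rfl
    · have hzW : (τ, x) ∉ W := fun h => hx h.2
      rw [indicator_of_notMem hzW, indicator_of_notMem (show x ∉ {x | c < ‖u τ x‖} from hx)]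
  rw [hI1, hI0, hI2] at hH
  simpa only [one_div] using hH

/-- **The crux implies the iso-speed AREA LAW** (stub `stub_isoSpeedAreaLaw` of line
`iso-speed-area-closure`, as a CONSEQUENCE of `HighSpeedPressureWork`): with `(m, Λ)` of the linear
level-set law supplied by the crux (`levelSetModeration_linearLevelSetLaw_of_highSpeedPressureWork`),
`ν 𝒟¹_c(T) ≤ √(V_c(T)) √(ν² D_c(T)) ≤ √(Λ⁺ M^m) V_c(T)`, i.e. the area law with `m₁ = m/2 < 5/3` and
`Λ₁ = √(Λ⁺)` (`levelSetModeration_isoSpeedArea_le_sqrt`). [folklore] -/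
theorem levelSetModeration_isoSpeedAreaLaw_of_highSpeedPressureWork : Summit.NavierStokesRegularity.NavierStokesRegularity.Theses.LevelSetModeration.HighSpeedPressureWork → ∀ (ν T : ℝ), 0 < ν → 0 < T → ∃ m₁ : ℝ, m₁ < 5 / 3 ∧ ∃ Λ₁ : ℝ → ℝ → ℝ, ∀ (u : ℝ → EuclideanSpace ℝ (Fin 3) → EuclideanSpace ℝ (Fin 3)) (p : ℝ → EuclideanSpace ℝ (Fin 3) → ℝ), Literature.Analysis.FluidPDE.IsClassicalNSSolutionOn (Set.Ico 0 T) ν 0 u p → Literature.Analysis.FluidPDE.IsLerayHopfOn T ν 0 (u 0) u → Literature.Analysis.FluidPDE.HasRapidSpatialDecay (u 0) → ∀ (E₀ B₀ : ℝ), (∫ x, ‖u 0 x‖ ^ 2) ≤ E₀ → (∀ x, ‖u 0 x‖ ≤ B₀) → ∀ (M c : ℝ), 2 * B₀ ≤ M → M / 2 ≤ c → c ≤ M → 0 < c → ν * (∫⁻ τ in Set.Ioo 0 T, ∫⁻ x, Set.indicator {x | c < ‖u τ x‖} (fun x => ENNReal.ofReal ‖fderiv ℝ (fun y => ‖u τ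 y‖) x‖) x).toReal ≤ Λ₁ E₀ B₀ * M ^ m₁ * (∫⁻ τ in Set.Ioo 0 T, volume {x | c < ‖u τ x‖}).toReal := by
  intro hX ν T hν hT
  obtain ⟨m, hm, Λ, hlaw⟩ := levelSetModeration_linearLevelSetLaw_of_highSpeedPressureWork hX ν T hν hT
  refine ⟨m / 2, by linarith, fun E₀ B₀ => Real.sqrt (max (Λ E₀ B₀) 0), ?_⟩
  intro u p hcl hLH hdec E₀ B₀ hE₀ hB₀ M c hM hMc hcM hc
  have hMpos : 0 < M := by linarith
  obtain ⟨hD, -⟩ := hlaw u p hcl hLH hdec E₀ B₀ hE₀ hB₀ M c hM hMc hcM hc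
  -- names
  set V : ℝ≥0∞ := ∫⁻ τ in Ioo 0 T, volume {x | c < ‖u τ x‖} with hV
  set D : ℝ≥0∞ := ∫⁻ τ in Ioo 0 T, ∫⁻ x, {x | c < ‖u τ x‖}.indicator
    (fun x => ENNReal.ofReal (‖fderiv ℝ (fun y => ‖u τ y‖) x‖ ^ 2)) x with hDdef
  set A : ℝ≥0∞ := ∫⁻ τ in Ioo 0 T, ∫⁻ x, {x | c < ‖u τ x‖}.indicator
    (fun x => ENNReal.ofReal ‖fderiv ℝ (fun y => ‖u τ y‖) x‖) x with hA
  have hVfin : V ≠ ⊤ := ne_top_of_le_ne_top ENNReal.ofReal_ne_top (levelSetVolume_le hLH hν.le hT.le hc)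
  have hDfin : D ≠ ⊤ := (levelSetDissipation_ne_top hcl hLH hT hν.le hc.le).1
  -- Cauchy–Schwarz in extended reals, then in reals
  have hCS := levelSetModeration_isoSpeedArea_le_sqrt hcl.smooth_velocity hc (T := T)
  have hAfin : A ≠ ⊤ := by
    refine ne_top_of_le_ne_top ?_ hCS
    exact ENNReal.mul_ne_top (ENNReal.rpow_ne_top_of_nonneg (by norm_num) hVfin)
      (ENNReal.rpow_ne_top_of_nonneg (by norm_num) hDfin)
  have hCSr : A.toReal ≤ Real.sqrt V.toReal * Real.sqrt D.toReal := by
    have h1 := ENNReal.toReal_mono (ENNReal.mul_ne_top (ENNReal.rpow_ne_top_of_nonneg (by norm_num) hVfin)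
      (ENNReal.rpow_ne_top_of_nonneg (by norm_num) hDfin)) hCS
    rwa [ENNReal.toReal_mul, ← ENNReal.toReal_rpow, ← ENNReal.toReal_rpow, ← Real.sqrt_eq_rpow,
      ← Real.sqrt_eq_rpow] at h1
  -- the linear law: `ν² D ≤ Λ M^m V`, hence `≤ Λ⁺ M^m V`
  have hV0 : 0 ≤ V.toReal := ENNReal.toReal_nonneg
  have hD0 : 0 ≤ D.toReal := ENNReal.toReal_nonneg
  have hMm : 0 ≤ M ^ m := Real.rpow_nonneg hMpos.le m
  have hlaw' : ν ^ 2 * D.toReal ≤ max (Λ E₀ B₀) 0 * M ^ m * V.toReal := by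
    refine hD.trans ?_
    gcongr
    exact le_max_left _ _
  -- `ν A ≤ √V √(ν² D) ≤ √V √(Λ⁺ M^m V) = √Λ⁺ M^{m/2} V`
  have hνD : Real.sqrt (ν ^ 2 * D.toReal) = ν * Real.sqrt D.toReal := by
    rw [Real.sqrt_mul (sq_nonneg ν), Real.sqrt_sq hν.le]
  calc ν * A.toReal ≤ ν * (Real.sqrt V.toReal * Real.sqrt D.toReal) :=
        mul_le_mul_of_nonneg_left hCSr hν.le
    _ = Real.sqrt V.toReal * Real.sqrt (ν ^ 2 * D.toReal) := by rw [hνD]; ring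
    _ ≤ Real.sqrt V.toReal * Real.sqrt (max (Λ E₀ B₀) 0 * M ^ m * V.toReal) := by
        gcongr
    _ = Real.sqrt (max (Λ E₀ B₀) 0) * M ^ (m / 2) * V.toReal := by
        rw [Real.sqrt_mul (by positivity), Real.sqrt_mul (le_max_right _ _),
          Real.sqrt_eq_rpow (M ^ m), ← Real.rpow_mul hMpos.le]
        have : m * (1 / 2) = m / 2 := by ring
        rw [this]
        have hsq : Real.sqrt V.toReal * Real.sqrt V.toReal = V.toReal := Real.mul_self_sqrt hV0
        calc Real.sqrt V.toReal * (Real.sqrt (max (Λ E₀ B₀) 0) * M ^ (m / 2) * Real.sqrt V.toReal)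
            = Real.sqrt (max (Λ E₀ B₀) 0) * M ^ (m / 2) * (Real.sqrt V.toReal * Real.sqrt V.toReal) := by
              ring
          _ = Real.sqrt (max (Λ E₀ B₀) 0) * M ^ (m / 2) * V.toReal := by rw [hsq]

end Summit.NavierStokesRegularity.NavierStokesRegularity.Theorems

end
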